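/-
  stub-ideation k = 3 (g42) · technique «decomposition (split into sub-stubs with a provable glue)» ·
  crux `SplitBadTwoLowerHalfOfFacts` (stmt-BirchSwinnertonDyer-27851) · stub `stub_heegnerIndexLowerAtTwo`
  of the ACTIVE skeleton `f2bd84c029a8a938` (FIXED; not re-typed here).

  WHAT THIS FILE TYPES AND PROVES (nothing here proves BSD, the crux, or the stub): the JUNCTION **J** of
  STUB-PLAN v7.4 §3 (xlv) / CRITIC-ROWS-g41 (P-iv) — «LOWER's R∃ wants the value ON AN `IsKatzMeasure₂`
  WITNESS; the frame outputs `∫ρ_v dμ = c(key)·Σ…` for WHICHEVER measure it is run on» — CUT into three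
  typed pieces with the glue PROVED, and the middle piece (the transport itself) PROVED:

    R∃ (= the binder `hR` of `RubinValueTwoLower.lower_two_of_DGal_of_subsetForall_of_katzValueExists`)
      ⟸  J-a FRAME      `IsKatzMeasure₂ ι v v̄ S κ₁ κ₂ γ₁⁻¹ γ₂⁻¹ λ Ω δ Ω_p (katzObjectInv μ l)`      (tree, by name)
       ∧  J-b TRANSPORT  `(katzObjectInv μ l)(r(γ₁⁻¹) − 1, r(γ₂⁻¹) − 1) = ∫_{Γ_K} r·l dμ`            (NEW — PROVED below,
                          for EVERY `r` factoring through the pair: in the cone OR OUTSIDE it)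
       ∧  J-c VALUE      `‖∫_{Γ_K} r·l dμ‖ = 2^{−M/2}` in MEASURE currency, for every fact-witness `μ`  (residual; the
                          output of HARDEST (a) ⊕ (b): frame (i-c) + A′'s `IsCosetValues` + RT⁺/D3/(G))

  `katzObjectInv μ l` is THE Katz object the tree builds from an `IsLMeasure` witness (de Shalit II.4.17 (54):
  reindex `μ` along the congruence levels of `(κ₁, κ₂)`, twist by the avatar `l` of `λ`, push forward to `ℤ_p²`,
  reflect by `−1 ∈ M₂(ℤ_p)`, two-variable Amice transform in `𝒪_{ℂ_p}⟦T₁⟧⟦T₂⟧`).  `IsKatzMeasure₂` constrains its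
  values ONLY on the cone `0 ≤ j < m`; the stub's deciding point `ρ = θ_K·(ψ∘c)⁻¹` (type `(0, −1)` at `v`) and
  A′'s finite-order `𝔭`-ramified cosets lie OUTSIDE it, where only the CONSTRUCTION speaks — J-b is that
  statement, valid at every point of the open polydisc coming from a character through the pair.
  0 `sorry`.  The four `def`s (`LMeasureFactWith`, `FrameData`, `MeasureValue`, `MeasureValueWitness`) are the
  sub-stub SIGNATURES of the cut (Props, not claims); §7 re-keys the LOWER consumer itself through the cut.
-/
import Literature.NumberTheory.EllipticCurves.DeShalit1987.LMeasureExistence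
import Summits.BirchSwinnertonDyer.BirchSwinnertonDyer.Theorems.PrintCf2RubinValueTwoLowerOfKatzValueExists
import HarnessLib

noncomputable section

open NumberField IsDedekindDomain Field
open Literature.NumberTheory.GaloisRepresentations
open Literature.NumberTheory.EllipticCurves
open Literature.NumberTheory.EllipticCurves.DeShalit1987

set_option linter.dupNamespace false
set_option autoImplicit false

namespace Summit.BirchSwinnertonDyer.BirchSwinnertonDyer.Cruxes.SplitBadTwoLowerHalfOfFacts.JunctionK3G42

variable {p : ℕ} [Fact p.Prime] {K : Type} [Field K] [NumberField K]

/-! ## §1 The Katz object of record attached to an `IsLMeasure` witness -/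

section Object

variable {𝒰 : SubgroupTower (absoluteGaloisGroup K)} {κ₁ κ₂ : ZpExtension K p}

/-- **The Katz object of record at the inverse generators**, `G₂(μ, l) ∈ 𝒪_{ℂ_p}⟦T₁⟧⟦T₂⟧`: the two-variable
Amice transform of the `(−1)`-REFLECTED push-forward `π_*(l·μ)·(−1)` of the `l`-twisted measure along
`σ ↦ (κ₁σ, κ₂σ)` — verbatim the witness inside the tree's
`DeShalit1987.IsKatzDistribution₂.isKatzMeasure₂_amice₂Int_inv` applied to `katzDistribution₂ μ … l …`.
(de Shalit II.4.16 (49) `π_*(λ̂⁻¹μ(𝔣))`, II.4.17 (53)–(54) `G(χ; T₁, T₂)`, read at `(γ₁⁻¹, γ₂⁻¹)`.) -/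
def katzObjectInv (μ : GroupDistribution 𝒰 ℂ_[p]) (hb : μ.bound ≤ 1)
    (hpc : 𝒰.IsTowerContinuous (ZpExtension.pairCoord κ₁ κ₂))
    (l : FramedGaloisRep K (PadicAlgCl p) 1) (hl : 𝒰.IsTowerContinuous (fun σ ↦ avatarValueAt l σ)) :
    PowerSeries (PowerSeries (PadicComplexInt p)) :=
  ((katzDistribution₂ μ hpc l hl).linearMap (-1) 0 0 (-1)).amice₂Int
    (BoundedDistribution.linearMap_neg_one_bound_le ((katzDistribution₂_bound μ hpc l hl).le.trans hb))

/-! ## §2 J-b — THE TRANSPORT: the value of the object of record at ANY pair-point is the Galois integral -/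

/-- **J-b «VALUE TRANSPORT AT THE JUNCTION» (kernel).**  For every bounded (`‖μ‖ ≤ 1`) distribution `μ` on
`Γ_K` along `𝒰`, every tower-continuous `l`, every generator pair `(γ₁, γ₂)` of `(κ₁, κ₂)` and EVERY
rank-one `r` factoring through the pair — no range / infinity-type / ramification / `L`-function
hypothesis — the Katz object of record takes at the consumer's point `(r(γ₁⁻¹) − 1, r(γ₂⁻¹) − 1)` the value

  `∫_{Γ_K} r(σ)·l(σ) dμ(σ)`.

Proof = de Shalit II.4.17 (52)–(54) beyond the cone: `(γ₁⁻¹, γ₂⁻¹)` is a generator pair of the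
`(−1)`-twisted pair, through which `r` still factors; its descent `F = pairChar` is a continuous character of
`ℤ_p²` with `F(1,0) = r(γ₁⁻¹)`, `F(0,1) = r(γ₂⁻¹)` (principal units); the character-evaluation theorem
`hasValueAt₂_amice₂Int` gives the value `∫ F d(π_*(l·μ)·(−1)) = ∫ F∘(−1) dπ_*(l·μ)`, and `F∘(−1)` is the
descent of `r` through `(κ₁, κ₂)`, so the change of variables `integral_katzDistribution₂` yields `∫ r·l dμ`.
The `(−1)`-reflection (the critic's «`δ`/sign conventions of `isKatzDistribution₂` matched once») is
consumed HERE, once, for all points. -/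
theorem hasValueAt₂_katzObjectInv (μ : GroupDistribution 𝒰 ℂ_[p]) (hb : μ.bound ≤ 1)
    (hpc : 𝒰.IsTowerContinuous (ZpExtension.pairCoord κ₁ κ₂))
    (l : FramedGaloisRep K (PadicAlgCl p) 1) (hl : 𝒰.IsTowerContinuous (fun σ ↦ avatarValueAt l σ))
    {γ₁ γ₂ : absoluteGaloisGroup K} (hγ : ZpExtension.IsTopGeneratorPair κ₁ κ₂ γ₁ γ₂)
    {r : FramedGaloisRep K (PadicAlgCl p) 1} (hκ : FactorsThroughPair κ₁ κ₂ r) :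
    IntSeries.HasValueAt₂ (katzObjectInv μ hb hpc l hl) (avatarValueAt r γ₁⁻¹ - 1) (avatarValueAt r γ₂⁻¹ - 1)
      (μ.integral fun σ ↦ avatarValueAt r σ * avatarValueAt l σ) := by
  -- the `(−1)`-twisted pair, its generator pair `(γ₁⁻¹, γ₂⁻¹)`, and the descent of `r` through it
  have hγ' := hγ.unitTwist_neg_one_inv
  have h' : (κ₁.unitTwist (-1)).IsIndependent (κ₂.unitTwist (-1)) := hγ'.isIndependent
  have h : κ₁.IsIndependent κ₂ := hγ.isIndependent
  have hκ' : FactorsThroughPair (κ₁.unitTwist (-1)) (κ₂.unitTwist (-1)) r :=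
    (ZpExtension.factorsThroughPair_unitTwist_iff (-1) (-1) r).mpr hκ
  have hD : (katzDistribution₂ μ hpc l hl).bound ≤ 1 := (katzDistribution₂_bound μ hpc l hl).le.trans hb
  have hFc : IsContinuousChar₂ (ZpExtension.pairChar h' r) := ZpExtension.isContinuousChar₂_pairChar hκ' hγ' h'
  -- character evaluation of the Amice transform of the reflected distribution
  have hval := ((katzDistribution₂ μ hpc l hl).linearMap (-1) 0 0 (-1)).hasValueAt₂_amice₂Int
    (BoundedDistribution.linearMap_neg_one_bound_le hD) hFc
  rw [ZpExtension.pairChar_one_zero hκ' hγ' h', ZpExtension.pairChar_zero_one hκ' hγ' h'] at hval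
  -- `F ∘ (−1)` is the descent of `r` through the ORIGINAL pair
  have hFneg : ∀ σ, (ZpExtension.pairChar h' r ∘ linMap (-1) 0 0 (-1)) (ZpExtension.pairCoord κ₁ κ₂ σ) =
      avatarValueAt r σ := by
    intro σ
    have hFσ : ZpExtension.pairChar h' r (ZpExtension.pairCoord (κ₁.unitTwist (-1)) (κ₂.unitTwist (-1)) σ) =
        avatarValueAt r σ := ZpExtension.pairChar_pairCoord h' hκ' σ
    rw [Function.comp_apply, ← hFσ, ZpExtension.pairCoord_unitTwist_neg_one, linMap_apply,
      ZpExtension.pairCoord_apply]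
    simp only [neg_mul, one_mul, zero_mul, add_zero, zero_add, Prod.neg_mk]
  have hFeq : ZpExtension.pairChar h' r ∘ linMap (-1) 0 0 (-1) = ZpExtension.pairChar h r :=
    ZpExtension.eq_pairChar_of_forall_apply_pairCoord h hκ hFneg
  have hFuc : UniformContinuous (ZpExtension.pairChar h' r) :=
    CompactSpace.uniformContinuous_of_continuous hFc.continuous
  have hGc : UniformContinuous (ZpExtension.pairChar h r) :=
    CompactSpace.uniformContinuous_of_continuous (ZpExtension.continuous_pairChar h hκ)
  have hG1 : ∀ x, ‖ZpExtension.pairChar h r x‖ ≤ 1 := fun x ↦ by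
    obtain ⟨σ, rfl⟩ := ZpExtension.pairCoord_surjective h x
    rw [ZpExtension.pairChar_pairCoord h hκ]
    exact (norm_avatarValueAt_eq_one r σ).le
  -- `∫ F d(D·(−1)) = ∫ F∘(−1) dD = ∫ pairChar dπ_*(l·μ) = ∫ r·l dμ`
  have hint : ((katzDistribution₂ μ hpc l hl).linearMap (-1) 0 0 (-1)).integral (ZpExtension.pairChar h' r) =
      μ.integral (fun σ ↦ avatarValueAt r σ * avatarValueAt l σ) := by
    rw [(katzDistribution₂ μ hpc l hl).integral_linearMap (-1) 0 0 (-1) hFuc, hFeq,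
      integral_katzDistribution₂ μ hpc l hl hGc hG1]
    exact μ.integral_congr fun σ ↦ by rw [ZpExtension.pairChar_pairCoord h hκ]
  rw [hint] at hval
  exact hval

/-- **The consumer's `val` IS the Galois integral** (kernel; values of a convergent two-variable series are
unique): whatever value a downstream argument attaches to the object of record at the point, it equals
`∫ r·l dμ` — so every statement about `val` is a statement in MEASURE currency. -/
theorem value_eq_integral (μ : GroupDistribution 𝒰 ℂ_[p]) (hb : μ.bound ≤ 1)
    (hpc : 𝒰.IsTowerContinuous (ZpExtension.pairCoord κ₁ κ₂))
    (l : FramedGaloisRep K (PadicAlgCl p) 1) (hl : 𝒰.IsTowerContinuous (fun σ ↦ avatarValueAt l σ))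
    {γ₁ γ₂ : absoluteGaloisGroup K} (hγ : ZpExtension.IsTopGeneratorPair κ₁ κ₂ γ₁ γ₂)
    {r : FramedGaloisRep K (PadicAlgCl p) 1} (hκ : FactorsThroughPair κ₁ κ₂ r) {val : ℂ_[p]}
    (hv : IntSeries.HasValueAt₂ (katzObjectInv μ hb hpc l hl) (avatarValueAt r γ₁⁻¹ - 1)
      (avatarValueAt r γ₂⁻¹ - 1) val) :
    val = μ.integral fun σ ↦ avatarValueAt r σ * avatarValueAt l σ :=
  hv.unique (hasValueAt₂_katzObjectInv μ hb hpc l hl hγ hκ)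

omit [NumberField K] in
/-- **The integrand `r·l` is the avatar of the PRODUCT character** (kernel): `r(σ)·l(σ) = (r ⊗ det l)(σ)`, so
`∫ r·l dμ = ∫ ê dμ` with `e := r ⊗ det l` — by the tree's `IsPAdicAvatarOf.mul_twist_outside`, `e` is the
avatar outside `S` of `ε = λρ` (for this stub: `λ = θ_K⁻¹`, `ρ = θ_K(ψ∘c)⁻¹`, `ε = (ψ∘c)⁻¹`, type `(0,−1)` —
OUTSIDE the cone at `v`), i.e. J-c below is literally the frame's `∫ ε̂ dμ`. -/
theorem integral_mul_eq_integral_twist (μ : GroupDistribution 𝒰 ℂ_[p])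
    (r l : FramedGaloisRep K (PadicAlgCl p) 1) :
    (μ.integral fun σ ↦ avatarValueAt r σ * avatarValueAt l σ) =
      μ.integral fun σ ↦ avatarValueAt (FramedRep.twist r (detChar l)) σ :=
  μ.integral_congr fun σ ↦ by rw [avatarValueAt_twist_detChar, mul_comm]

end Object

/-! ## §3 J-a — the FRAME of the object of record (tree, by name) and the witness-level glue -/

section Witness

variable {ι : PadicAlgCl p ≃+* ℂ} {v vbar : HeightOneSpectrum (𝓞 K)} {S : Finset (HeightOneSpectrum (𝓞 K))}
  {Ω δ : ℂ} {Ωp : ℂ_[p]} {𝒰 : SubgroupTower (absoluteGaloisGroup K)} {μ : GroupDistribution 𝒰 ℂ_[p]}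
  {κ₁ κ₂ : ZpExtension K p} {γ₁ γ₂ : absoluteGaloisGroup K}
  {lam : HeckeCharacter K} {l r : FramedGaloisRep K (PadicAlgCl p) 1}

/-- **J-a «FRAME» (tree, one line)**: for an `IsLMeasure` witness `μ` (de Shalit's (49)–(50) on `Γ_K`
along open `𝒰` with `⋂ U_n ⊆ Gal(K̄/K(𝔣p^∞))`), an avatar `l` of `λ` outside `S` with `λ` unramified
outside `S ∪ {w ∣ p}`, and a generator pair, the object of record IS a `λ`-frame at `(γ₁⁻¹, γ₂⁻¹)` —
`IsLMeasure.isKatzDistribution₂` ∘ `IsKatzDistribution₂.isKatzMeasure₂_amice₂Int_inv`. -/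
theorem isKatzMeasure₂_katzObjectInv (hμ : DeShalit1987.IsLMeasure ι v vbar S Ω δ Ωp 𝒰 μ)
    (hU : ∀ n, IsOpen (𝒰.U n : Set (absoluteGaloisGroup K)))
    (hN : ⋂ n, (𝒰.U n : Set (absoluteGaloisGroup K)) ⊆ DeShalit1987.rayKer K p S)
    (hvbar : ((p : ℕ) : 𝓞 K) ∈ vbar.asIdeal) (hb : μ.bound ≤ 1) (hl : IsPAdicAvatarOutside S ι lam l)
    (hlam : ∀ w : HeightOneSpectrum (𝓞 K), w ∉ S → ((p : ℕ) : 𝓞 K) ∉ w.asIdeal → lam.IsUnramifiedAt w)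
    (hγ : ZpExtension.IsTopGeneratorPair κ₁ κ₂ γ₁ γ₂) :
    IsKatzMeasure₂ ι v vbar S κ₁ κ₂ γ₁⁻¹ γ₂⁻¹ lam Ω δ Ωp
      (katzObjectInv μ hb (DeShalit1987.isTowerContinuous_pairCoord κ₁ κ₂ hU hN) l
        (DeShalit1987.isTowerContinuous_avatarValueAt hl hlam hU hN)) :=
  (hμ.isKatzDistribution₂ hU hN hvbar hl hlam hγ.isIndependent).isKatzMeasure₂_amice₂Int_inv
    ((katzDistribution₂_bound μ _ l _).le.trans hb) hγ

/-- **GLUE, witness level (kernel): J-a ∧ J-b ∧ J-c ⟹ R∃ on THIS witness.**  For ANY predicate `P` on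
`ℂ_p` (the consumer's is `‖·‖ = 2^{−M/2}`): if the Galois integral `∫ r·l dμ` satisfies `P`, then SOME Katz
`λ`-frame at `(γ₁⁻¹, γ₂⁻¹)` has at `(r(γ₁⁻¹) − 1, r(γ₂⁻¹) − 1)` SOME value satisfying `P` — the frame
being the object of record and the value the integral.  Road B′ = this theorem on `μ_cons` (after R220 J1),
road A′ = this theorem on the fact's witness (§4): junction J is paid ONCE for both roads. -/
theorem katzValueExists_of_witness {P : ℂ_[p] → Prop}
    (hμ : DeShalit1987.IsLMeasure ι v vbar S Ω δ Ωp 𝒰 μ)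
    (hU : ∀ n, IsOpen (𝒰.U n : Set (absoluteGaloisGroup K)))
    (hN : ⋂ n, (𝒰.U n : Set (absoluteGaloisGroup K)) ⊆ DeShalit1987.rayKer K p S)
    (hvbar : ((p : ℕ) : 𝓞 K) ∈ vbar.asIdeal) (hb : μ.bound ≤ 1) (hl : IsPAdicAvatarOutside S ι lam l)
    (hlam : ∀ w : HeightOneSpectrum (𝓞 K), w ∉ S → ((p : ℕ) : 𝓞 K) ∉ w.asIdeal → lam.IsUnramifiedAt w)
    (hγ : ZpExtension.IsTopGeneratorPair κ₁ κ₂ γ₁ γ₂) (hκ : FactorsThroughPair κ₁ κ₂ r)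
    (hval : P (μ.integral fun σ ↦ avatarValueAt r σ * avatarValueAt l σ)) :
    ∃ G₂ : PowerSeries (PowerSeries (PadicComplexInt p)),
      IsKatzMeasure₂ ι v vbar S κ₁ κ₂ γ₁⁻¹ γ₂⁻¹ lam Ω δ Ωp G₂ ∧
      ∃ val : ℂ_[p], IntSeries.HasValueAt₂ G₂ (avatarValueAt r γ₁⁻¹ - 1) (avatarValueAt r γ₂⁻¹ - 1) val ∧ P val :=
  ⟨_, isKatzMeasure₂_katzObjectInv hμ hU hN hvbar hb hl hlam hγ, _,
    hasValueAt₂_katzObjectInv μ hb _ l _ hγ hκ, hval⟩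

end Witness

/-! ## §4 The cut at FACT level: fact-shape(Extra) ∧ frame data ∧ J-c ⟹ R∃ (glue proved) -/

section Fact

variable {ι : PadicAlgCl p ≃+* ℂ} {v vbar : HeightOneSpectrum (𝓞 K)} {Sθ : Finset (HeightOneSpectrum (𝓞 K))}
  {κ₁ κ₂ : ZpExtension K p} {γ₁ γ₂ : absoluteGaloisGroup K}
  {lam : HeckeCharacter K} {l r : FramedGaloisRep K (PadicAlgCl p) 1}

/-- **SUB-STUB PIECE 1 — the fact SHAPE with an extra conjunct on the witness** (a `Prop`-valued
DEFINITION, not a claim): verbatim the body of `DeShalit1987.thmII414_exists_lMeasure` at `(p, K, ι, v, v̄)`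
with `∧ Extra 𝒰 μ` appended inside the inner existential.  `Extra := fun _ _ ↦ True` is fact A (up to
`∧ True`, `lMeasureFactWith_true_of_thmII414`); `Extra := IsCosetValues ι v v̄ S` (k2-g40, text of record of
road A′) is `thmII414_exists_lMeasure_cosetValues` at `(p, K, ι, v, v̄)` token for token. -/
def LMeasureFactWith (ι : PadicAlgCl p ≃+* ℂ) (v vbar : HeightOneSpectrum (𝓞 K))
    (Extra : Finset (HeightOneSpectrum (𝓞 K)) → (𝒰 : SubgroupTower (absoluteGaloisGroup K)) →
      GroupDistribution 𝒰 ℂ_[p] → Prop) : Prop :=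
  ∃ (Ω δ : ℂ) (Ωp : (unrIntegers p)ˣ), Ω ≠ 0 ∧
    (δ ^ 2 = (NumberField.discr K : ℂ) ∨ δ ^ 2 = -(NumberField.discr K : ℂ)) ∧
    ∀ (S : Finset (HeightOneSpectrum (𝓞 K))), v ∉ S → vbar ∉ S →
      ∃ (𝒰 : SubgroupTower (absoluteGaloisGroup K)) (μ : GroupDistribution 𝒰 ℂ_[p]),
        (∀ n, IsOpen (𝒰.U n : Set (absoluteGaloisGroup K))) ∧
        (⋂ n, (𝒰.U n : Set (absoluteGaloisGroup K))) ⊆ DeShalit1987.rayKer K p S ∧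
        μ.bound ≤ 1 ∧
        DeShalit1987.IsLMeasure ι v vbar S Ω δ ((Ωp : unrIntegers p) : ℂ_[p]) 𝒰 μ ∧
        Extra S 𝒰 μ

/-- **Fact A gives the shape with `Extra := True`** (kernel projection). -/
theorem lMeasureFactWith_true_of_thmII414 (hA : DeShalit1987.thmII414_exists_lMeasure)
    (hK : IsImaginaryQuadratic K) (ι : PadicAlgCl p ≃+* ℂ) (v vbar : HeightOneSpectrum (𝓞 K))
    (hv : ((p : ℕ) : 𝓞 K) ∈ v.asIdeal) (hvbar : ((p : ℕ) : 𝓞 K) ∈ vbar.asIdeal) (hne : vbar ≠ v)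
    (hι : ∀ (w : InfinitePlace K) (k : 𝓞 K), k ∈ v.asIdeal ↔ ‖ι.symm (w.embedding (k : K))‖ < 1) :
    LMeasureFactWith ι v vbar (fun _ _ _ ↦ True) := by
  obtain ⟨Ω, δ, Ωp, hΩ, hδ, hS⟩ := hA p K hK ι v vbar hv hvbar hne hι
  refine ⟨Ω, δ, Ωp, hΩ, hδ, fun S hvS hvbarS ↦ ?_⟩
  obtain ⟨𝒰, μ, h1, h2, h3, h4⟩ := hS S hvS hvbarS
  exact ⟨𝒰, μ, h1, h2, h3, h4, trivial⟩

/-- **SUB-STUB PIECE 3 — J-c «THE VALUE IN MEASURE CURRENCY»** (a `Prop`-valued DEFINITION, not a claim;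
the RESIDUAL of the cut = the output of HARDEST (a) ⊕ (b)): for EVERY admissible period triple and EVERY
witness `(𝒰, μ)` of the fact at the tame set `Sθ` carrying `Extra` (road A′: `IsCosetValues`), the Galois
integral of `r·l` satisfies `P` (the consumer's `P` is `‖·‖_{ℂ₂} = 2^{−M/2}`).  `∀`-keyed over witnesses
(G1-style, CRITIC-ROWS-g39 (e)): NO uniqueness of de Shalit's measure is consumed (K30/K53). -/
def MeasureValue (ι : PadicAlgCl p ≃+* ℂ) (v vbar : HeightOneSpectrum (𝓞 K)) (Sθ : Finset (HeightOneSpectrum (𝓞 K)))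
    (Extra : Finset (HeightOneSpectrum (𝓞 K)) → (𝒰 : SubgroupTower (absoluteGaloisGroup K)) →
      GroupDistribution 𝒰 ℂ_[p] → Prop)
    (r l : FramedGaloisRep K (PadicAlgCl p) 1) (P : ℂ_[p] → Prop) : Prop :=
  ∀ (Ω δ : ℂ) (Ωp : (unrIntegers p)ˣ) (𝒰 : SubgroupTower (absoluteGaloisGroup K)) (μ : GroupDistribution 𝒰 ℂ_[p]),
    (∀ n, IsOpen (𝒰.U n : Set (absoluteGaloisGroup K))) →
    (⋂ n, (𝒰.U n : Set (absoluteGaloisGroup K))) ⊆ DeShalit1987.rayKer K p Sθ → μ.bound ≤ 1 →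
    DeShalit1987.IsLMeasure ι v vbar Sθ Ω δ ((Ωp : unrIntegers p) : ℂ_[p]) 𝒰 μ → Extra Sθ 𝒰 μ →
    P (μ.integral fun σ ↦ avatarValueAt r σ * avatarValueAt l σ)

/-- **SUB-STUB PIECE 2 — the FRAME DATA at the tame set** (a `Prop`-valued DEFINITION, not a claim; the
home of K3 «generator match» / the frame's (F1)–(F3) bookkeeping): `v, v̄ ∉ Sθ`, `l` is an avatar of `λ`
outside `Sθ`, `λ` is unramified outside `Sθ ∪ {v, v̄}`, `(γ₁, γ₂)` generates `(κ₁, κ₂)`, `r` factors through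
the pair.  For this stub: `λ = θ_K⁻¹` (`l` from the consumer's `θ` via `IsHeckeCharOf ι θ θK`), `r` = the
consumer's `r` (`hrpair`). -/
def FrameData (ι : PadicAlgCl p ≃+* ℂ) (v vbar : HeightOneSpectrum (𝓞 K)) (Sθ : Finset (HeightOneSpectrum (𝓞 K)))
    (κ₁ κ₂ : ZpExtension K p) (γ₁ γ₂ : absoluteGaloisGroup K) (lam : HeckeCharacter K)
    (l r : FramedGaloisRep K (PadicAlgCl p) 1) : Prop :=
  v ∉ Sθ ∧ vbar ∉ Sθ ∧ IsPAdicAvatarOutside Sθ ι lam l ∧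
    (∀ w : HeightOneSpectrum (𝓞 K), w ∉ Sθ → w ≠ v → w ≠ vbar → lam.IsUnramifiedAt w) ∧
    ZpExtension.IsTopGeneratorPair κ₁ κ₂ γ₁ γ₂ ∧ FactorsThroughPair κ₁ κ₂ r

/-- **THE GLUE OF THE CUT (kernel): PIECE 1 (fact shape, any `Extra`) → PIECE 2 (frame data) → PIECE 3 (J-c)
→ R∃**, in the consumer's currency (`Ω ≠ 0`, `δ² = ±d_K`, `Ω_p ∈ (𝒪^{unr})ˣ`, `IsKatzMeasure₂` of the
`λ`-frame at the inverse generators, a value at `(r(γ₁⁻¹) − 1, r(γ₂⁻¹) − 1)` satisfying `P`).  The proof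
runs J-a and J-b on the fact's witness at `S = Sθ`. -/
theorem katzValueExists_of_cut
    {Extra : Finset (HeightOneSpectrum (𝓞 K)) → (𝒰 : SubgroupTower (absoluteGaloisGroup K)) →
      GroupDistribution 𝒰 ℂ_[p] → Prop} {P : ℂ_[p] → Prop}
    (hfact : LMeasureFactWith ι v vbar Extra)
    (hv : ((p : ℕ) : 𝓞 K) ∈ v.asIdeal) (hvbar : ((p : ℕ) : 𝓞 K) ∈ vbar.asIdeal)
    (hframe : FrameData ι v vbar Sθ κ₁ κ₂ γ₁ γ₂ lam l r)
    (hval : MeasureValue ι v vbar Sθ Extra r l P) :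
    ∃ (Ω δ : ℂ) (Ωp : (unrIntegers p)ˣ) (G₂ : PowerSeries (PowerSeries (PadicComplexInt p))),
      Ω ≠ 0 ∧ (δ ^ 2 = (NumberField.discr K : ℂ) ∨ δ ^ 2 = -(NumberField.discr K : ℂ)) ∧
      IsKatzMeasure₂ ι v vbar Sθ κ₁ κ₂ γ₁⁻¹ γ₂⁻¹ lam Ω δ ((Ωp : unrIntegers p) : ℂ_[p]) G₂ ∧
      ∃ val : ℂ_[p], IntSeries.HasValueAt₂ G₂ (avatarValueAt r γ₁⁻¹ - 1) (avatarValueAt r γ₂⁻¹ - 1) val ∧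
        P val := by
  obtain ⟨hvS, hvbarS, hl, hlam, hγ, hκ⟩ := hframe
  obtain ⟨Ω, δ, Ωp, hΩ, hδ, hS⟩ := hfact
  obtain ⟨𝒰, μ, hU, hN, hb, hμ, hE⟩ := hS Sθ hvS hvbarS
  have hlam' : ∀ w : HeightOneSpectrum (𝓞 K), w ∉ Sθ → ((p : ℕ) : 𝓞 K) ∉ w.asIdeal → lam.IsUnramifiedAt w :=
    fun w hwS hwp ↦ hlam w hwS (fun h ↦ hwp (h ▸ hv)) (fun h ↦ hwp (h ▸ hvbar))
  obtain ⟨G₂, hG₂, val, hvalG, hP⟩ := katzValueExists_of_witness hμ hU hN hvbar hb hl hlam' hγ hκ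
    (hval Ω δ Ωp 𝒰 μ hU hN hb hμ hE)
  exact ⟨Ω, δ, Ωp, G₂, hΩ, hδ, hG₂, val, hvalG, hP⟩

/-- **Road A (cite world, fact A as it stands): `thmII414_exists_lMeasure` ∧ frame data ∧ J-c(Extra := True)
⟹ R∃** (kernel). -/
theorem katzValueExists_of_thmII414 {P : ℂ_[p] → Prop}
    (hA : DeShalit1987.thmII414_exists_lMeasure) (hK : IsImaginaryQuadratic K)
    (hv : ((p : ℕ) : 𝓞 K) ∈ v.asIdeal) (hvbar : ((p : ℕ) : 𝓞 K) ∈ vbar.asIdeal) (hne : vbar ≠ v)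
    (hι : ∀ (w : InfinitePlace K) (k : 𝓞 K), k ∈ v.asIdeal ↔ ‖ι.symm (w.embedding (k : K))‖ < 1)
    (hframe : FrameData ι v vbar Sθ κ₁ κ₂ γ₁ γ₂ lam l r)
    (hval : MeasureValue ι v vbar Sθ (fun _ _ _ ↦ True) r l P) :
    ∃ (Ω δ : ℂ) (Ωp : (unrIntegers p)ˣ) (G₂ : PowerSeries (PowerSeries (PadicComplexInt p))),
      Ω ≠ 0 ∧ (δ ^ 2 = (NumberField.discr K : ℂ) ∨ δ ^ 2 = -(NumberField.discr K : ℂ)) ∧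
      IsKatzMeasure₂ ι v vbar Sθ κ₁ κ₂ γ₁⁻¹ γ₂⁻¹ lam Ω δ ((Ωp : unrIntegers p) : ℂ_[p]) G₂ ∧
      ∃ val : ℂ_[p], IntSeries.HasValueAt₂ G₂ (avatarValueAt r γ₁⁻¹ - 1) (avatarValueAt r γ₂⁻¹ - 1) val ∧
        P val :=
  katzValueExists_of_cut (lMeasureFactWith_true_of_thmII414 hA hK ι v vbar hv hvbar hne hι) hv hvbar hframe hval

end Fact

/-! ## §4b The WEAKEST residual: ONE witness (∃-keyed) — no fact hypothesis at all -/

section Exists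

variable {ι : PadicAlgCl p ≃+* ℂ} {v vbar : HeightOneSpectrum (𝓞 K)} {Sθ : Finset (HeightOneSpectrum (𝓞 K))}
  {κ₁ κ₂ : ZpExtension K p} {γ₁ γ₂ : absoluteGaloisGroup K}
  {lam : HeckeCharacter K} {l r : FramedGaloisRep K (PadicAlgCl p) 1}

/-- **J-c∃ «ONE WITNESS»** (a `Prop`-valued DEFINITION, not a claim): SOME admissible period triple and
SOME `IsLMeasure` witness `(𝒰, μ)` at the tame set `Sθ` whose Galois integral of `r·l` satisfies `P`.
By J-a ⊕ J-b this ALONE (with the frame data) gives R∃ — it is what LOWER needs in measure currency,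
nothing more; the `∀`-keyed `MeasureValue` ⊕ the fact is one way to produce it (`measureValueWitness_of_cut`). -/
def MeasureValueWitness (ι : PadicAlgCl p ≃+* ℂ) (v vbar : HeightOneSpectrum (𝓞 K))
    (Sθ : Finset (HeightOneSpectrum (𝓞 K))) (r l : FramedGaloisRep K (PadicAlgCl p) 1)
    (P : ℂ_[p] → Prop) : Prop :=
  ∃ (Ω δ : ℂ) (Ωp : (unrIntegers p)ˣ) (𝒰 : SubgroupTower (absoluteGaloisGroup K)) (μ : GroupDistribution 𝒰 ℂ_[p]),
    Ω ≠ 0 ∧ (δ ^ 2 = (NumberField.discr K : ℂ) ∨ δ ^ 2 = -(NumberField.discr K : ℂ)) ∧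
    (∀ n, IsOpen (𝒰.U n : Set (absoluteGaloisGroup K))) ∧
    (⋂ n, (𝒰.U n : Set (absoluteGaloisGroup K))) ⊆ DeShalit1987.rayKer K p Sθ ∧ μ.bound ≤ 1 ∧
    DeShalit1987.IsLMeasure ι v vbar Sθ Ω δ ((Ωp : unrIntegers p) : ℂ_[p]) 𝒰 μ ∧
    P (μ.integral fun σ ↦ avatarValueAt r σ * avatarValueAt l σ)

/-- **GLUE (∃ form, kernel): frame data ∧ ONE witness ⟹ R∃.** -/
theorem katzValueExists_of_measureValueWitness {P : ℂ_[p] → Prop}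
    (hv : ((p : ℕ) : 𝓞 K) ∈ v.asIdeal) (hvbar : ((p : ℕ) : 𝓞 K) ∈ vbar.asIdeal)
    (hframe : FrameData ι v vbar Sθ κ₁ κ₂ γ₁ γ₂ lam l r)
    (hW : MeasureValueWitness ι v vbar Sθ r l P) :
    ∃ (Ω δ : ℂ) (Ωp : (unrIntegers p)ˣ) (G₂ : PowerSeries (PowerSeries (PadicComplexInt p))),
      Ω ≠ 0 ∧ (δ ^ 2 = (NumberField.discr K : ℂ) ∨ δ ^ 2 = -(NumberField.discr K : ℂ)) ∧
      IsKatzMeasure₂ ι v vbar Sθ κ₁ κ₂ γ₁⁻¹ γ₂⁻¹ lam Ω δ ((Ωp : unrIntegers p) : ℂ_[p]) G₂ ∧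
      ∃ val : ℂ_[p], IntSeries.HasValueAt₂ G₂ (avatarValueAt r γ₁⁻¹ - 1) (avatarValueAt r γ₂⁻¹ - 1) val ∧
        P val := by
  obtain ⟨-, -, hl, hlam, hγ, hκ⟩ := hframe
  obtain ⟨Ω, δ, Ωp, 𝒰, μ, hΩ, hδ, hU, hN, hb, hμ, hP⟩ := hW
  have hlam' : ∀ w : HeightOneSpectrum (𝓞 K), w ∉ Sθ → ((p : ℕ) : 𝓞 K) ∉ w.asIdeal → lam.IsUnramifiedAt w :=
    fun w hwS hwp ↦ hlam w hwS (fun h ↦ hwp (h ▸ hv)) (fun h ↦ hwp (h ▸ hvbar))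
  obtain ⟨G₂, hG₂, val, hvalG, hPv⟩ := katzValueExists_of_witness hμ hU hN hvbar hb hl hlam' hγ hκ hP
  exact ⟨Ω, δ, Ωp, G₂, hΩ, hδ, hG₂, val, hvalG, hPv⟩

/-- **The `∀`-keyed cut produces the witness** (kernel): fact shape (any `Extra`) ∧ `v, v̄ ∉ Sθ` ∧
`MeasureValue` ⟹ `MeasureValueWitness`. -/
theorem measureValueWitness_of_cut
    {Extra : Finset (HeightOneSpectrum (𝓞 K)) → (𝒰 : SubgroupTower (absoluteGaloisGroup K)) →
      GroupDistribution 𝒰 ℂ_[p] → Prop} {P : ℂ_[p] → Prop}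
    (hfact : LMeasureFactWith ι v vbar Extra) (hvS : v ∉ Sθ) (hvbarS : vbar ∉ Sθ)
    (hval : MeasureValue ι v vbar Sθ Extra r l P) :
    MeasureValueWitness ι v vbar Sθ r l P := by
  obtain ⟨Ω, δ, Ωp, hΩ, hδ, hS⟩ := hfact
  obtain ⟨𝒰, μ, hU, hN, hb, hμ, hE⟩ := hS Sθ hvS hvbarS
  exact ⟨Ω, δ, Ωp, 𝒰, μ, hΩ, hδ, hU, hN, hb, hμ, hval Ω δ Ωp 𝒰 μ hU hN hb hμ hE⟩

end Exists


/-! ## §5 The stub's instance: `p = 2`, `λ = θ_K⁻¹`, `P = (‖·‖ = 2^{−M/2})` — the consumer's `hR` token for token -/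

section Two

variable {K : Type} [Field K] [NumberField K]
  {ι : PadicAlgCl 2 ≃+* ℂ} {v vbar : HeightOneSpectrum (𝓞 K)} {Sθ : Finset (HeightOneSpectrum (𝓞 K))}
  {κ₁ κ₂ : ZpExtension K 2} {γ₁ γ₂ : absoluteGaloisGroup K}
  {θK : HeckeCharacter K} {l r : FramedGaloisRep K (PadicAlgCl 2) 1}

/-- **R∃ AT `p = 2` FROM THE CUT (kernel)** — conclusion = the binder `hR` of
`RubinValueTwoLower.lower_two_of_DGal_of_subsetForall_of_katzValueExists` VERBATIM (`Sθ`, `θK⁻¹`,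
`(Ωp : unrIntegers 2 : ℂ_[2])`, `‖val‖ = 2^{−M/2}`): the LOWER junction consumes, in measure currency, exactly
`MeasureValue ι v v̄ Sθ Extra r l (‖·‖ = 2^{−M/2})` — ONE norm of ONE Galois integral per witness. -/
theorem katzValueExists_two
    {Extra : Finset (HeightOneSpectrum (𝓞 K)) → (𝒰 : SubgroupTower (absoluteGaloisGroup K)) →
      GroupDistribution 𝒰 ℂ_[2] → Prop} {M : ℤ}
    (hfact : LMeasureFactWith ι v vbar Extra)
    (hv : ((2 : ℕ) : 𝓞 K) ∈ v.asIdeal) (hvbar : ((2 : ℕ) : 𝓞 K) ∈ vbar.asIdeal)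
    (hframe : FrameData ι v vbar Sθ κ₁ κ₂ γ₁ γ₂ θK⁻¹ l r)
    (hval : MeasureValue ι v vbar Sθ Extra r l (fun z ↦ ‖z‖ = (2 : ℝ) ^ (-(M : ℝ) / 2))) :
    ∃ (Ω δ : ℂ) (Ωp : (unrIntegers 2)ˣ) (G₂ : PowerSeries (PowerSeries (PadicComplexInt 2))),
      Ω ≠ 0 ∧ (δ ^ 2 = (NumberField.discr K : ℂ) ∨ δ ^ 2 = -(NumberField.discr K : ℂ)) ∧
      IsKatzMeasure₂ ι v vbar Sθ κ₁ κ₂ γ₁⁻¹ γ₂⁻¹ θK⁻¹ Ω δ ((Ωp : unrIntegers 2) : ℂ_[2]) G₂ ∧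
      ∃ val : ℂ_[2], IntSeries.HasValueAt₂ G₂ (avatarValueAt r γ₁⁻¹ - 1) (avatarValueAt r γ₂⁻¹ - 1) val ∧
        ‖val‖ = (2 : ℝ) ^ (-(M : ℝ) / 2) :=
  katzValueExists_of_cut hfact hv hvbar hframe hval

end Two

/-! ## §6 Degenerate-instance checks (B68): the pieces are not vacuous / not trivially true -/

section Checks

variable {𝒰 : SubgroupTower (absoluteGaloisGroup K)} {κ₁ κ₂ : ZpExtension K p}

/-- (B68-i) J-b is NOT an instance of the frame: it holds with NO `IsLMeasure` hypothesis at all (the zero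
measure included) — at `μ` with `∫ ≡ 0`-style degenerate data the value is the integral, whatever it is; the
content of J-b is the IDENTIFICATION, and the frame J-a is where (49)–(50) enter.  Recorded as the trivial
re-export below so the critic can see the hypothesis list of J-b contains no `L`-function datum. -/
theorem hasValueAt₂_katzObjectInv_hypotheses (μ : GroupDistribution 𝒰 ℂ_[p]) (hb : μ.bound ≤ 1)
    (hpc : 𝒰.IsTowerContinuous (ZpExtension.pairCoord κ₁ κ₂))
    (l : FramedGaloisRep K (PadicAlgCl p) 1) (hl : 𝒰.IsTowerContinuous (fun σ ↦ avatarValueAt l σ))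
    {γ₁ γ₂ : absoluteGaloisGroup K} (hγ : ZpExtension.IsTopGeneratorPair κ₁ κ₂ γ₁ γ₂)
    {r : FramedGaloisRep K (PadicAlgCl p) 1} (hκ : FactorsThroughPair κ₁ κ₂ r) :
    ∃ val : ℂ_[p], IntSeries.HasValueAt₂ (katzObjectInv μ hb hpc l hl) (avatarValueAt r γ₁⁻¹ - 1)
      (avatarValueAt r γ₂⁻¹ - 1) val ∧ val = μ.integral fun σ ↦ avatarValueAt r σ * avatarValueAt l σ :=
  ⟨_, hasValueAt₂_katzObjectInv μ hb hpc l hl hγ hκ, rfl⟩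

/-- (B68-ii) `MeasureValue` is NOT vacuous whenever the fact shape holds at `Sθ ∌ v, v̄`: it is then
EQUIVALENT to its instance on some witness existing — in particular `MeasureValue … (fun _ ↦ False)` is
refutable (so the `∀`-keying hides no empty quantifier). -/
theorem not_measureValue_false {ι : PadicAlgCl p ≃+* ℂ} {v vbar : HeightOneSpectrum (𝓞 K)}
    {Sθ : Finset (HeightOneSpectrum (𝓞 K))}
    {Extra : Finset (HeightOneSpectrum (𝓞 K)) → (𝒰 : SubgroupTower (absoluteGaloisGroup K)) →
      GroupDistribution 𝒰 ℂ_[p] → Prop}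
    (hfact : LMeasureFactWith ι v vbar Extra) (hvS : v ∉ Sθ) (hvbarS : vbar ∉ Sθ)
    (r l : FramedGaloisRep K (PadicAlgCl p) 1) :
    ¬ MeasureValue ι v vbar Sθ Extra r l (fun _ ↦ False) := by
  intro h
  obtain ⟨Ω, δ, Ωp, -, -, hS⟩ := hfact
  obtain ⟨𝒰, μ, hU, hN, hb, hμ, hE⟩ := hS Sθ hvS hvbarS
  exact h Ω δ Ωp 𝒰 μ hU hN hb hμ hE

end Checks

/-! ## §7 THE LOWER CONSUMER RE-KEYED IN MEASURE CURRENCY (kernel composition; junction J consumed) -/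

section Consumer

open scoped Classical
open WeierstrassCurve
open Literature.NumberTheory.EllipticCurves.Rank1Residual
open Literature.NumberTheory.EllipticCurves.GreenbergSelmer
open Literature.NumberTheory.EllipticCurves.IwasawaDual
open Literature.NumberTheory.EllipticCurves.KellerYin2024
open Summit.BirchSwinnertonDyer.BirchSwinnertonDyer.Theorems
open Summit.BirchSwinnertonDyer.BirchSwinnertonDyer.Theorems.PrintCf2

variable {K : Type} [Field K] [NumberField K]
  {d : ℤ} {W : WeierstrassCurve ℚ} [W.IsElliptic] [W.IsGloballyMinimal] {C : VariableChange ℚ}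
  {v vbar : HeightOneSpectrum (𝓞 K)} {ψ : HeckeCharacter K}

/-- **LOWER's one-sided value law with `hR` REPLACED by the three pieces of the cut (kernel).**  Verbatim
the binders of `RubinValueTwoLower.lower_two_of_DGal_of_subsetForall_of_katzValueExists` with its `hR`
(«SOME admissible triple, SOME Katz `G₂`, SOME value of norm `2^{−M/2}`») replaced by: PIECE 1 the fact
shape `LMeasureFactWith ι v v̄ Extra` (road A: `Extra := True` from `thmII414_exists_lMeasure`; road A′:
`Extra := IsCosetValues`), PIECE 2 the frame data at `Sθ` (`v, v̄ ∉ Sθ`, an avatar `l` of `θ_K⁻¹` outside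
`Sθ`, `θ_K⁻¹` unramified outside `Sθ ∪ {v, v̄}`; the pair data are the consumer's own `hpair`, `hrpair`),
PIECE 3 `MeasureValue … (‖·‖ = 2^{−M/2})` — ONE norm of ONE Galois integral `∫ r·l dμ` per witness.
Conclusion unchanged: the Greenberg–Vatsal datum with `M ≤ 2n`.  BSD is not proved; the `⊆` clause
`hMCall` (MC⁻, route C) and the print `hD` stay hypotheses exactly as in the consumer. -/
theorem lower_two_of_DGal_of_subsetForall_of_measureValue
    (hD : Deuring_galoisAction_cmPrimaryTorsion_split)
    (hd0 : d ≠ 0) (hsq : Squarefree d) (hd4 : d % 4 ≠ 1) (hC : C • W = cm7.quadraticTwist (d : ℚ)) (hrk : W.analyticRank = 1)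
    (hsha : Finite W.sha) (hK : IsImaginaryQuadratic K)
    (hv : ((2 : ℕ) : 𝓞 K) ∈ v.asIdeal) (hvbar : ((2 : ℕ) : 𝓞 K) ∈ vbar.asIdeal) (hne : vbar ≠ v)
    (ι : PadicAlgCl 2 ≃+* ℂ)
    (hι : ∀ (wi : InfinitePlace K) (k : 𝓞 K), k ∈ v.asIdeal ↔ ‖ι.symm (wi.embedding (k : K))‖ < 1)
    (c : K ≃ₐ[ℚ] K) (hc : c ≠ 1) (hψ : ψ.HasInfinityType (fun _ ↦ 1) (fun _ ↦ 0))
    (hL : ∀ s : ℂ, 3 / 2 < s.re → heckeLFunction ψ s = W.LSeries s)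
    {κ₁ κ₂ : ZpExtension K 2} {γ₁ γ₂ : absoluteGaloisGroup K} (hpair : ZpExtension.IsTopGeneratorPair κ₁ κ₂ γ₁ γ₂)
    (hκ₂ : κ₂.IsUnramifiedOutside vbar)
    {θ : FramedGaloisRep K (padicCoeffIntegers (∅ : Set (PadicAlgCl 2))) 1} {θK ρ : HeckeCharacter K}
    {r : FramedGaloisRep K (PadicAlgCl 2) 1}
    (hθ2 : ∀ σ : absoluteGaloisGroup K, θ σ ^ 2 = 1) (hθθK : IsHeckeCharOf ι θ θK) (hρr : IsPAdicAvatarOf ι ρ r)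
    (hrpair : FactorsThroughPair κ₁ κ₂ r) (hρ : θK⁻¹ * ρ = (HeckeCharacter.galConj c ψ)⁻¹)
    (Sθ : Finset (HeightOneSpectrum (𝓞 K)))
    (hMCall : ∀ (Ω δ : ℂ) (Ωp : (unrIntegers 2)ˣ) (G₂ : PowerSeries (PowerSeries (PadicComplexInt 2))),
      Ω ≠ 0 → (δ ^ 2 = (NumberField.discr K : ℂ) ∨ δ ^ 2 = -(NumberField.discr K : ℂ)) →
      IsKatzMeasure₂ ι v vbar Sθ κ₁ κ₂ γ₁⁻¹ γ₂⁻¹ θK⁻¹ Ω δ ((Ωp : unrIntegers 2) : ℂ_[2]) G₂ →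
      ∀ D₂ : DualData₂ κ₁ κ₂ (charModule (∅ : Set (PadicAlgCl 2)) θ) vbar γ₁ γ₂,
        Module.Finite (IwasawaAlgebra₂ 2) D₂.X ∧ Module.IsTorsion (IwasawaAlgebra₂ 2) D₂.X ∧
        ∀ (J : ℤ_[2] →+* PadicComplexInt 2),
          (∀ x : ℤ_[2], ((J x : PadicComplexInt 2) : ℂ_[2]) = ((x : ℚ_[2]) : ℂ_[2])) →
          (Module.charIdeal (IwasawaAlgebra₂ 2) D₂.X).map (PowerSeries.map (PowerSeries.map J)) ≤ Ideal.span {G₂})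
    {M : ℤ}
    -- ▼ the three pieces of the cut, in place of `hR`
    {Extra : Finset (HeightOneSpectrum (𝓞 K)) → (𝒰 : SubgroupTower (absoluteGaloisGroup K)) →
      GroupDistribution 𝒰 ℂ_[2] → Prop}
    (hfact : LMeasureFactWith ι v vbar Extra)
    {l : FramedGaloisRep K (PadicAlgCl 2) 1} (hvS : v ∉ Sθ) (hvbarS : vbar ∉ Sθ)
    (hl : IsPAdicAvatarOutside Sθ ι θK⁻¹ l)
    (hlam : ∀ w : HeightOneSpectrum (𝓞 K), w ∉ Sθ → w ≠ v → w ≠ vbar → θK⁻¹.IsUnramifiedAt w)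
    (hval : MeasureValue ι v vbar Sθ Extra r l (fun z ↦ ‖z‖ = (2 : ℝ) ^ (-(M : ℝ) / 2)))
    -- ▲
    (P : W.toAffine.Point) (c₀ : ℕ) (ℓ : ℤ) (hP : ¬ IsOfFinAddOrder P)
    (hgen : ∀ R : W.toAffine.Point, ∃ (k : ℤ) (T : W.toAffine.Point), IsOfFinAddOrder T ∧ R = k • P + T)
    (hc₀ : c₀ ≠ 0) (hker : (W.baseChange ℚ_[2]).IsInReductionKernel (c₀ • W.toPadicPoint 2 P))
    (hlog : ‖(W.baseChange ℚ_[2]).padicLogPoint (c₀ • W.toPadicPoint 2 P) / (c₀ : ℚ_[2])‖ = (2 : ℝ) ^ (-ℓ)) :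
    ∃ (π : (W.baseChange K).endRing) (_ : (π : AddMonoid.End (W.baseChange K).geomPoints) * π = π - 2)
      (r₀ : ℤ_[2]) (_ : r₀ * r₀ = r₀ - 2)
      (_ : ∀ τ ∈ GreenbergSelmer.inertia v, ∀ x : ↥((W.baseChange K).endEigenPrimaryTorsion 2 π r₀), τ • x = x ∨ τ • x = -x)
      (D : GreenbergVatsal2000.DatumDualData κ₂ γ₂ ↥((W.baseChange K).endEigenPrimaryTorsion 2 π r₀)
        (Castella2018.AcSelmer.bdpData ↥((W.baseChange K).endEigenPrimaryTorsion 2 π r₀) 2 vbar) ∅) (n : ℕ) (H : IwasawaAlgebra 2),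
      Module.Finite (IwasawaAlgebra 2) D.X ∧ Module.IsTorsion (IwasawaAlgebra 2) D.X ∧
      Module.charIdeal (IwasawaAlgebra 2) D.X = Ideal.span {H} ∧ PowerSeries.constantCoeff H ≠ 0 ∧
      (PowerSeries.constantCoeff H).valuation = n ∧ M ≤ 2 * (n : ℤ) :=
  RubinValueTwoLower.lower_two_of_DGal_of_subsetForall_of_katzValueExists hD hd0 hsq hd4 hC hrk hsha hK hv hvbar
    hne ι hι c hc hψ hL hpair hκ₂ hθ2 hθθK hρr hrpair hρ Sθ hMCall
    (katzValueExists_two hfact hv hvbar ⟨hvS, hvbarS, hl, hlam, hpair, hrpair⟩ hval) P c₀ ℓ hP hgen hc₀ hker hlog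

end Consumer

end Summit.BirchSwinnertonDyer.BirchSwinnertonDyer.Cruxes.SplitBadTwoLowerHalfOfFacts.JunctionK3G42

end
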